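import Summits.AtomisticToContinuum.HydrodynamicLimit.Theses.InformationPercolationEngine

/-!
# Negative-lane helpers for crux `PercolationClosesChaos` (stmt-AtomisticToContinuum-13914):
the outgoing-direction law under the flux measure — uniform in `d = 3`, NOT in `d = 2`

One-variable shadows behind findings F3/F5 of the standing disproof record
(`Cruxes/PercolationClosesChaos/Disproof.lean`, cycle 3, §6c) of the crux
`PercolationClosesChaos : KickIsotropyInfo → SpectralContractionR → ContactChaos`
(route InformationPercolationEngine). No statement of the route is asserted here, positively or
negatively; ideators, planners and provers may import the lemmas.

Let `θ ∈ (0, π/2)` be the angle between the impact vector `ω` and the incoming relative velocity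
`q = v − w` of a hard-sphere collision `collide ω (v, w)`. By the kinematic identity
`⟪q, q/2 − ⟪q, ω⟫ω⟫ = ‖q‖²/2 − ⟪q, ω⟫²` (`Negative.inner_half_sub_reflect`, CollisionSphereKinematics)
the cosine between the incoming and the OUTGOING relative direction is `t = 1 − 2cos²θ = −cos 2θ`.

* `d = 3` (hard spheres). The flux (Knudsen) law of `θ` is `cos θ sin θ dθ ∝ sin 2θ dθ`, and
  `t = −cos 2θ` is then UNIFORM on `[−1, 1]` (`integral_comp_outgoingCos_d3`, the substitution
  `t = −cos 2θ`; Archimedes' hat-box theorem in one variable): hard spheres scatter isotropically in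
  the centre-of-mass frame. In particular the first moment vanishes (`flux_moment_cos_two_mul_d3`).
  This is the measure-level step behind F3 (`K` = two-output operator, PSD, joint-parent χ²-ratio
  `λ₂(K)`) and F5 (`CrossOpEqOp`: the cross operator `E[f(w′) | v]` equals `K`, since `w′` is the
  antipode of `v′` on the collision sphere — `Negative.collide_fst_sub_cm_eq_neg` — and the uniform
  law is antipodally symmetric). In print: Cercignani, *The Boltzmann Equation and Its
  Applications* (1988), Ch. IV §5, Eqs. (5.5)–(5.7): rotating `n` through `π/2` in the collision
  plane (`θ → π/2 − θ`, `ε → ε ± π`, unit Jacobian) turns `ξ′_*` into `ξ′`, so the two gain terms of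
  the linearised operator coincide for every kernel with `B(θ) = B(π/2 − θ)` — rigid spheres,
  `B ∝ V sin θ cos θ`.
* `d = 2` (hard DISKS) — refutation of the dimension-free strengthening. The flux law of `θ` is
  `cos θ dθ` on `(−π/2, π/2)` and the first moment of the outgoing direction is
  `∫ cos 2θ cos θ dθ / ∫ cos θ dθ = (2/3)/2 = 1/3 ≠ 0` (`flux_moment_cos_two_mul_d2`,
  `flux_mass_d2`): planar hard-disk scattering is NOT isotropic in the centre-of-mass frame, the law
  of `t` is not symmetric under `t ↦ −t`, hence `E[f(w′) | v] ≠ E[f(v′) | v]` already for `f`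
  linear in the relative direction. So "outgoing direction uniform", `TwoOutputFormEqK` and
  `CrossOpEqOp` are `d = 3` facts with no analogue for the dimension-generic kinetic files of the
  tree (`EuclideanSpace ℝ d`): a prover must not try to establish them for general `d`.
-/

namespace Summit.AtomisticToContinuum.HydrodynamicLimit.Theorems.PercolationClosesChaos.Negative

open Real MeasureTheory intervalIntegral Set

/-! ## `d = 3`: the outgoing cosine is uniform under the flux law -/

/-- **Archimedes in one variable (`d = 3`).** Under the flux law `∝ sin 2θ dθ` on `(0, π/2)` the
outgoing cosine `t = −cos 2θ` is uniform on `[−1, 1]`: for every continuous `g`,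
`∫₀^{π/2} g(−cos 2θ) · 2 sin 2θ dθ = ∫_{−1}^{1} g(t) dt`. [folklore] -/
theorem integral_comp_outgoingCos_d3 (g : ℝ → ℝ) (hg : Continuous g) :
    ∫ θ in (0 : ℝ)..(π / 2), g (-cos (2 * θ)) * (2 * sin (2 * θ)) = ∫ t in (-1 : ℝ)..1, g t := by
  have hderiv : ∀ x ∈ uIcc (0 : ℝ) (π / 2),
      HasDerivAt (fun θ : ℝ => -cos (2 * θ)) (2 * sin (2 * x)) x := by
    intro x _
    have h1 : HasDerivAt (fun θ : ℝ => 2 * θ) 2 x := by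
      simpa using (hasDerivAt_id x).const_mul (2 : ℝ)
    have h2 : HasDerivAt (fun θ : ℝ => cos (2 * θ)) (-sin (2 * x) * 2) x :=
      (hasDerivAt_cos (2 * x)).comp x h1
    exact h2.neg.congr_deriv (by ring)
  have hcont : ContinuousOn (fun x : ℝ => 2 * sin (2 * x)) (uIcc (0 : ℝ) (π / 2)) :=
    (continuous_const.mul (continuous_sin.comp (continuous_const.mul continuous_id))).continuousOn
  have h := integral_comp_mul_deriv hderiv hcont hg
  have h0 : -cos (2 * (0 : ℝ)) = -1 := by simp
  have h1 : -cos (2 * (π / 2)) = 1 := by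
    rw [show 2 * (π / 2) = π by ring, cos_pi]; norm_num
  rw [h0, h1] at h
  simpa [Function.comp] using h

/-- The flux weight in the two usual forms: `2 sin 2θ = 4 sin θ cos θ`. [folklore] -/
theorem two_mul_sin_two_mul (θ : ℝ) : 2 * sin (2 * θ) = 4 * (sin θ * cos θ) := by
  rw [sin_two_mul]; ring

/-- Total flux mass in `d = 3` (with the normalisation of `integral_comp_outgoingCos_d3`):
`∫₀^{π/2} 2 sin 2θ dθ = 2`. [folklore] -/
theorem flux_mass_d3 : ∫ θ in (0 : ℝ)..(π / 2), (2 * sin (2 * θ)) = 2 := by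
  have h := integral_comp_outgoingCos_d3 (fun _ => (1 : ℝ)) continuous_const
  simp only [one_mul] at h
  rw [h]
  simp
  norm_num

/-- **Isotropy, first moment (`d = 3`).** `∫₀^{π/2} (−cos 2θ) · 2 sin 2θ dθ = 0`: the mean outgoing
cosine vanishes — the uniform law on `[−1, 1]` is symmetric, as `CrossOpEqOp` (F5) requires.
[folklore] -/
theorem flux_moment_cos_two_mul_d3 :
    ∫ θ in (0 : ℝ)..(π / 2), (-cos (2 * θ)) * (2 * sin (2 * θ)) = 0 := by
  have h := integral_comp_outgoingCos_d3 (fun t => t) continuous_id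
  rw [h, integral_id]
  norm_num

/-! ## `d = 2`: hard disks do not scatter isotropically -/

/-- Total flux mass in `d = 2`: `∫_{−π/2}^{π/2} cos θ dθ = 2`. [folklore] -/
theorem flux_mass_d2 : ∫ θ in (-(π / 2))..(π / 2), cos θ = 2 := by
  rw [integral_cos, sin_pi_div_two, sin_neg, sin_pi_div_two]
  norm_num

/-- **Anisotropy of planar hard-disk scattering (`d = 2`).** Under the flux law `cos θ dθ` on
`(−π/2, π/2)`, `∫ cos 2θ cos θ dθ = 2/3`; with `flux_mass_d2` the mean of `cos 2θ` is `1/3 ≠ 0`,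
i.e. the mean OUTGOING cosine `t = −cos 2θ` is `−1/3` while that of the partner's (antipodal)
direction is `+1/3`: the cross operator `E[f(w′) | v]` and the direct one `E[f(v′) | v]` differ in
`d = 2` — the dimension-free strengthening of `CrossOpEqOp` / `TwoOutputFormEqK` is false.
[folklore] -/
theorem flux_moment_cos_two_mul_d2 :
    ∫ θ in (-(π / 2))..(π / 2), cos (2 * θ) * cos θ = 2 / 3 := by
  have hderiv : ∀ x ∈ uIcc (-(π / 2)) (π / 2),
      HasDerivAt (fun θ : ℝ => sin θ / 2 + sin (3 * θ) / 6) (cos (2 * x) * cos x) x := by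
    intro x _
    have h1 : HasDerivAt (fun θ : ℝ => sin θ / 2) (cos x / 2) x := (hasDerivAt_sin x).div_const 2
    have h3x : HasDerivAt (fun θ : ℝ => 3 * θ) 3 x := by
      simpa using (hasDerivAt_id x).const_mul (3 : ℝ)
    have h2 : HasDerivAt (fun θ : ℝ => sin (3 * θ) / 6) (cos (3 * x) * 3 / 6) x :=
      ((hasDerivAt_sin (3 * x)).comp x h3x).div_const 6
    refine (h1.add h2).congr_deriv ?_
    rw [cos_three_mul, cos_two_mul]
    ring
  have hint : IntervalIntegrable (fun x : ℝ => cos (2 * x) * cos x) volume (-(π / 2)) (π / 2) :=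
    ((continuous_cos.comp (continuous_const.mul continuous_id)).mul continuous_cos).intervalIntegrable _ _
  rw [integral_eq_sub_of_hasDerivAt hderiv hint]
  have hs1 : sin (π / 2) = 1 := sin_pi_div_two
  have hs3 : sin (3 * (π / 2)) = -1 := by
    rw [show 3 * (π / 2) = π / 2 + π by ring, sin_add_pi, sin_pi_div_two]
  have hs1' : sin (-(π / 2)) = -1 := by rw [sin_neg, sin_pi_div_two]
  have hs3' : sin (3 * -(π / 2)) = 1 := by
    rw [show 3 * -(π / 2) = -(3 * (π / 2)) by ring, sin_neg, hs3]; norm_num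
  simp only [hs1, hs3, hs1', hs3']
  norm_num

/-- The two dimensions side by side: the normalised first moment of `cos 2θ` under the flux law is
`0` for spheres and `1/3` for disks. [folklore] -/
theorem flux_mean_cos_two_mul_d3_ne_d2 :
    (∫ θ in (0 : ℝ)..(π / 2), (-cos (2 * θ)) * (2 * sin (2 * θ))) / (∫ θ in (0 : ℝ)..(π / 2), (2 * sin (2 * θ)))
      ≠ -((∫ θ in (-(π / 2))..(π / 2), cos (2 * θ) * cos θ) / (∫ θ in (-(π / 2))..(π / 2), cos θ)) := by
  rw [flux_moment_cos_two_mul_d3, flux_mass_d3, flux_moment_cos_two_mul_d2, flux_mass_d2]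
  norm_num

end Summit.AtomisticToContinuum.HydrodynamicLimit.Theorems.PercolationClosesChaos.Negative
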